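import Mathlib
import HarnessLib
import Summits.Langlands.Langlands.Theorems.NonParallelVoidEmptyWeightCoreStubModPCyclotomicOnInertia
import Literature.NumberTheory.GaloisRepresentations.LocalClassFieldTheory
import Literature.NumberTheory.GaloisRepresentations.ModPGaloisRepCyclotomicProofs
import Literature.NumberTheory.GaloisRepresentations.PadicAlgebraOfLocalField
import Literature.NumberTheory.Automorphic.LParameter

/-!
# CFT helper for stub `stub_unramifiedOutsidePVoid` (line `merged`, crux `TensorSquareParallel`,
# stmt-Langlands-17009): the local Artin map of `-1` acts on `p`-power roots of unity by `-1`

Let `K` be a `p`-adic field with `e = f = 1` (`residueFieldCard K = p`, `p` a uniformiser), `p` odd,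
and `art : W_K →* Kˣ` ANY homomorphism with the characterising clauses `IsLocalArtinMap K art` of the
tree (`LocalClassFieldTheory.lean`; e.g. THE map `canonicalArtin K`, `isLocalArtinMap_canonicalArtin_holds`).
Then for every `x` in the inertia subgroup of `W_K` with `art x = -1`, the `p`-adic cyclotomic character
of `x` is `-1` (`cyclotomicCharacter_toAbsGalois_eq_neg_one_of_artin_eq_neg_one`).  This is the only
piece of the explicit reciprocity law `ε_p ∘ Art = N` on units (the tree's NAMED FACT
`cyclotomicCharacter_artin_eq_norm`, unproved) that the parity argument of stub 7a needs, and it is proved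
here OUTRIGHT, normalisation-free (it holds for Deligne's and for Serre's normalisation alike):

* `e = ε_p ∘ (W_K → Γ_K)` is continuous (`WeilGroup.continuous_toAbsGalois_holds`) with abelian Hausdorff
  target, so it kills `ker art = closure [W_K, W_K]` (`IsLocalArtinMap.ker_artin`); hence `e(x)² = 1`.
* mod `p`: `ε̄_p` is ONTO `𝔽_pˣ` on `I_K` for `e = f = 1` (landed stub `stub_modPCyclotomicOnInertia` of the
  sibling crux `EmptyWeightCore`: Serre's `θ_{p-1} = χ` for `e = 1`, Invent. Math. 15 (1972) §1.8), and
  `art` maps `I_K` onto `𝒪_Kˣ` (`image_inertia`), which maps onto `k_Kˣ = 𝔽_pˣ` with kernel the one-units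
  `U¹`; a one-unit is a `(p-1)`-th power (Hensel in the complete DVR `𝒪_K`,
  `exists_pow_eq_of_sub_one_mem_maximalIdeal`), so `ε̄_p ∘ art⁻¹` kills `U¹`; two surjections of the
  inertia group onto groups of order `p - 1` whose kernels are nested have the same kernel; `-1 ∉ U¹`
  (`p ≠ 2`), so `ε̄_p(x) ≠ 1`, whence `ε_p(x) = -1`.

References: J.-P. Serre, *Local class field theory* (Cassels–Fröhlich Ch. VI) §3.1 Thm. 2 (the printed
law `σ_u ζ = ζ^{u⁻¹}`); J.-P. Serre, Invent. Math. 15 (1972) §1.8 Prop. 8 and Cor.  No `sorry`, no new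
definition, no named fact.
-/

-- project-wide option (lakefile weak.linter.dupNamespace); `Summit.Langlands.Langlands` is mandated
set_option linter.dupNamespace false

noncomputable section

namespace Summit.Langlands.Langlands.Theorems.TensorSquareParallel

open Literature.NumberTheory.GaloisRepresentations Field ValuativeRel Polynomial
open Literature.NumberTheory.GaloisRepresentations.IsNonarchimedeanLocalField (residueFieldCard)
open Summit.Langlands.Langlands.Cruxes.EmptyWeightCore.LocalClauseCut (stub_modPCyclotomicOnInertia)

section LocalKey

variable {K : Type} [Field K] [ValuativeRel K] [TopologicalSpace K] [IsNonarchimedeanLocalField K]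

/-- **Hensel for `Xⁿ - u` at `1`.**  In the valuation ring `𝒪_K` of a non-archimedean local field
(complete, `LocalField.isAdicComplete_maximalIdeal`, hence Henselian, Mathlib
`IsAdicComplete.henselianRing`), an element `u ≡ 1 (mod 𝓂_K)` is an `n`-th power as soon as `n` is
a unit of `𝒪_K` (`Xⁿ - u` has the simple root `1` modulo `𝓂_K`).
[cite: SerreLocalFields1979, Ch. II §4 Prop. 7] -/
theorem exists_pow_eq_of_sub_one_mem_maximalIdeal {n : ℕ} (hn : IsUnit ((n : ℕ) : 𝒪[K]))
    (hn0 : n ≠ 0) {u : 𝒪[K]} (hu : u - 1 ∈ 𝓂[K]) : ∃ z : 𝒪[K], z ^ n = u := by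
  haveI := LocalField.isAdicComplete_maximalIdeal K
  have hmonic : (X ^ n - C u : (𝒪[K])[X]).Monic := monic_X_pow_sub_C u hn0
  have h1 : ((X ^ n - C u : (𝒪[K])[X])).eval 1 ∈ 𝓂[K] := by
    rw [eval_sub, eval_pow, eval_X, eval_C, one_pow, ← Ideal.neg_mem_iff, neg_sub]
    exact hu
  have h2 : IsUnit (Ideal.Quotient.mk 𝓂[K] (((X ^ n - C u : (𝒪[K])[X])).derivative.eval 1)) := by
    rw [derivative_sub, derivative_X_pow, derivative_C, sub_zero, eval_mul, eval_C, eval_pow, eval_X,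
      one_pow, mul_one]
    exact hn.map _
  obtain ⟨z, hz, -⟩ := HenselianRing.is_henselian (I := 𝓂[K]) _ hmonic 1 h1 h2
  refine ⟨z, ?_⟩
  have hz' := hz.eq_zero
  rwa [eval_sub, eval_pow, eval_X, eval_C, sub_eq_zero] at hz'

/-- **The local Artin map of `-1` acts on the `p`-power roots of unity by `-1`** (`e = f = 1`, `p`
odd).  Let `K` be a non-archimedean local field of characteristic `0` with residue field `𝔽_p` in
which `p` is a uniformiser, `art : W_K →* Kˣ` a homomorphism with the characterising clauses
`IsLocalArtinMap K art`, and `x ∈ W_K` an inertia element with `art x = -1`.  Then `ε_p(x) = -1`.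
Printed source: Serre's explicit law `(u, ℚ_p^{cycl}/ℚ_p) ζ = ζ^{u⁻¹}` for `u ∈ ℤ_pˣ` (at `u = -1` both
normalisations agree); proved here from the surjectivity of `ε̄_p` on inertia (Serre 1972 §1.8,
`stub_modPCyclotomicOnInertia`), Hensel, and a count of indices — see the module docstring.
[cite: SerreLCFT1967, §3.1 Thm. 2] [cite: SerreInventiones1972, §1.8 Prop. 8 and Cor.] -/
theorem cyclotomicCharacter_toAbsGalois_eq_neg_one_of_artin_eq_neg_one [CharZero K] (p : ℕ)
    [Fact p.Prime] (hp2 : p ≠ 2) (hq : residueFieldCard K = p) (hirr : Irreducible ((p : ℕ) : 𝒪[K]))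
    {art : WeilGroup K →* Kˣ} (hart : IsLocalArtinMap K art) {x : WeilGroup K}
    (hx : x ∈ WeilGroup.inertia K) (hax : art x = -1) :
    GaloisRep.cyclotomicCharacter K p (WeilGroup.toAbsGalois K x) = -1 := by
  classical
  have hp : p.Prime := Fact.out
  -- the residue characteristic of `K` is `p`
  have hchar : ringChar 𝓀[K] = p := by
    obtain ⟨f, -, hf⟩ := IsNonarchimedeanLocalField.residueFieldCard_eq_pow_ringChar K
    rw [hq] at hf
    exact (hp.pow_eq_iff.1 hf.symm).1
  -- `e = ε_p ∘ (W_K → Γ_K)`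
  set ε := GaloisRep.cyclotomicCharacter K p with hε
  set e : WeilGroup K →* ℤ_[p]ˣ := ε.toMonoidHom.comp (WeilGroup.toAbsGalois K) with he_def
  have he : ∀ y, e y = ε (WeilGroup.toAbsGalois K y) := fun y => rfl
  -- (1) `e` kills `ker art = closure [W_K, W_K]`
  have hker : ∀ y : WeilGroup K, art y = 1 → e y = 1 := by
    intro y hy
    have hy' : y ∈ (art.ker : Set (WeilGroup K)) := hy
    rw [hart.ker_artin] at hy'
    have hcont : Continuous e := ε.continuous.comp (WeilGroup.continuous_toAbsGalois_holds K)
    have hclosed : IsClosed ((e.ker : Subgroup (WeilGroup K)) : Set (WeilGroup K)) := by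
      have h1 : ((e.ker : Subgroup (WeilGroup K)) : Set (WeilGroup K)) = e ⁻¹' {1} := by
        ext z; exact MonoidHom.mem_ker
      rw [h1]
      exact isClosed_singleton.preimage hcont
    have hle : (commutator (WeilGroup K) : Set (WeilGroup K)) ⊆ (e.ker : Set (WeilGroup K)) :=
      fun z hz => Abelianization.commutator_subset_ker e hz
    exact closure_minimal hle hclosed hy'
  have hcongr : ∀ y y' : WeilGroup K, art y = art y' → e y = e y' := by
    intro y y' h
    have h1 : art (y⁻¹ * y') = 1 := by rw [map_mul, map_inv, h, inv_mul_cancel]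
    have h2 := hker _ h1
    rwa [map_mul, map_inv, inv_mul_eq_one] at h2
  -- (2) `e(x)² = 1`, so `e x = 1 ∨ e x = -1`
  have hsq : e x * e x = 1 := by
    rw [← map_mul]
    refine hker _ ?_
    rw [map_mul, hax, neg_mul_neg, one_mul]
  have hdisj : e x = 1 ∨ e x = -1 := by
    have h := congrArg (fun u : ℤ_[p]ˣ => (u : ℤ_[p])) hsq
    simp only [Units.val_mul, Units.val_one] at h
    rcases mul_self_eq_one_iff.mp h with h1 | h1
    · exact Or.inl (Units.ext h1)
    · exact Or.inr (Units.ext (by rw [h1, Units.val_neg, Units.val_one]))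
  suffices hne : e x ≠ 1 from hdisj.resolve_left hne
  intro hex1
  -- (3) reduction mod `p` on the inertia group `I`
  set I : Subgroup (WeilGroup K) := WeilGroup.inertia K with hI
  set red : ℤ_[p]ˣ →* (ZMod p)ˣ := Units.map (PadicInt.toZMod (p := p)).toMonoidHom with hred
  set f₁ : I →* (ZMod p)ˣ := (red.comp e).comp I.subtype with hf₁
  have hf₁_apply : ∀ i : I, (f₁ i : ZMod p) =
      (modPCyclotomicCharacterZMod K p (WeilGroup.toAbsGalois K i) : ZMod p) := fun i =>
    toZMod_cyclotomicCharacter_apply K p _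
  -- `f₁` is onto: `ε̄_p(I_K) = 𝔽_pˣ`
  have hf₁surj : Function.Surjective f₁ := by
    obtain ⟨-, σ₀, hσ₀, hprim⟩ := stub_modPCyclotomicOnInertia K p hq hirr
    have hσ₀' : σ₀ ∈ (WeilGroup.inertia K).map (WeilGroup.toAbsGalois K) := by
      rw [WeilGroup.inertia_map_toAbsGalois]; exact hσ₀
    obtain ⟨x₀, hx₀I, hx₀⟩ := Subgroup.mem_map.mp hσ₀'
    have hgen : IsPrimitiveRoot (f₁ ⟨x₀, hx₀I⟩) (p - 1) := by
      rw [← IsPrimitiveRoot.coe_units_iff, hf₁_apply]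
      change IsPrimitiveRoot
        ((modPCyclotomicCharacterZMod K p (WeilGroup.toAbsGalois K x₀) : (ZMod p)ˣ) : ZMod p) (p - 1)
      rw [hx₀]; exact hprim
    haveI : NeZero (p - 1) := ⟨Nat.sub_ne_zero_of_lt hp.one_lt⟩
    intro t
    have ht : t ∈ Subgroup.zpowers (f₁ ⟨x₀, hx₀I⟩) := by
      rw [hgen.zpowers_eq, mem_rootsOfUnity]
      exact ZMod.units_pow_card_sub_one_eq_one p t
    obtain ⟨n, hn⟩ := Subgroup.mem_zpowers_iff.mp ht
    exact ⟨⟨x₀, hx₀I⟩ ^ n, by rw [map_zpow, hn]⟩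
  -- the unit side: `art(I) = 𝒪_Kˣ ↠ k_Kˣ`
  set A : ValuationSubring K := (valuation K).valuationSubring with hA
  have hmemU : ∀ i : I, (art.comp I.subtype) i ∈ A.unitGroup := fun i => by
    rw [hA, ← hart.image_inertia]; exact Subgroup.mem_map_of_mem _ i.2
  set aU : I →* A.unitGroup := (art.comp I.subtype).codRestrict A.unitGroup hmemU with haU
  have haU_coe : ∀ i : I, ((aU i : A.unitGroup) : Kˣ) = art i := fun i => rfl
  have haU_surj : Function.Surjective aU := by
    intro u
    have hu : (u : Kˣ) ∈ (WeilGroup.inertia K).map art := by rw [hart.image_inertia]; exact u.2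
    obtain ⟨j, hjI, hj⟩ := Subgroup.mem_map.mp hu
    exact ⟨⟨j, hjI⟩, Subtype.ext hj⟩
  set f₂ : I →* (IsLocalRing.ResidueField A)ˣ := A.unitGroupToResidueFieldUnits.comp aU with hf₂
  have hf₂surj : Function.Surjective f₂ :=
    A.surjective_unitGroupToResidueFieldUnits.comp haU_surj
  -- cardinalities: both targets have `p - 1` elements
  have hcard₁ : f₁.ker.index = p - 1 := by
    rw [Subgroup.index, Nat.card_congr (QuotientGroup.quotientKerEquivOfSurjective f₁ hf₁surj).toEquiv,
      Nat.card_eq_fintype_card, ZMod.card_units]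
  have hcardk : Nat.card (IsLocalRing.ResidueField A) = p := hq
  have hcard₂ : f₂.ker.index = p - 1 := by
    rw [Subgroup.index, Nat.card_congr (QuotientGroup.quotientKerEquivOfSurjective f₂ hf₂surj).toEquiv,
      Nat.card_units, hcardk]
  -- `ker f₂ ≤ ker f₁`: a one-unit is a `(p-1)`-th power (Hensel), and `f₁` has exponent `p - 1`
  have hpm : ((p : ℕ) : 𝒪[K]) ∈ 𝓂[K] := (IsLocalRing.mem_maximalIdeal _).2 hirr.not_isUnit
  have hunit : IsUnit (((p - 1 : ℕ) : ℕ) : 𝒪[K]) := by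
    have h1 : (((p - 1 : ℕ) : ℕ) : 𝒪[K]) = -(1 - (p : 𝒪[K])) := by
      rw [Nat.cast_sub hp.one_le, Nat.cast_one, neg_sub]
    rw [h1]
    exact (IsLocalRing.isUnit_one_sub_self_of_mem_nonunits _ hpm).neg
  have hle : f₂.ker ≤ f₁.ker := by
    intro i hi
    rw [MonoidHom.mem_ker] at hi ⊢
    -- `z = art i` as a unit of `𝒪_K`, with `z ≡ 1 (mod 𝓂)`
    set z : (A)ˣ := A.unitGroupMulEquiv (aU i) with hz
    have hz1 : (z : A) - 1 ∈ 𝓂[K] := by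
      have h1 : (f₂ i : IsLocalRing.ResidueField A) = 1 := by rw [hi, Units.val_one]
      rw [hf₂, MonoidHom.comp_apply, ValuationSubring.coe_unitGroupToResidueFieldUnits_apply, ← hz] at h1
      have h2 : Ideal.Quotient.mk (IsLocalRing.maximalIdeal A) (z : A) =
          Ideal.Quotient.mk (IsLocalRing.maximalIdeal A) 1 := h1.trans (map_one _).symm
      exact Ideal.Quotient.eq.mp h2
    obtain ⟨y, hy⟩ := exists_pow_eq_of_sub_one_mem_maximalIdeal hunit (Nat.sub_ne_zero_of_lt hp.one_lt) hz1
    have hyu : IsUnit y := (isUnit_pow_iff (Nat.sub_ne_zero_of_lt hp.one_lt)).mp (hy ▸ Units.isUnit z)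
    -- `y = art j` for some `j ∈ I`
    obtain ⟨j, hj⟩ := haU_surj (A.unitGroupMulEquiv.symm hyu.unit)
    have hartj : art (j : WeilGroup K) ^ (p - 1) = art (i : WeilGroup K) := by
      rw [← haU_coe, ← haU_coe, hj]
      apply Units.ext
      rw [Units.val_pow_eq_pow_val, ValuationSubring.coe_unitGroupMulEquiv_symm_apply, IsUnit.unit_spec,
        ← SubmonoidClass.coe_pow, hy, hz, ValuationSubring.coe_unitGroupMulEquiv_apply]
    have heij : e (i : WeilGroup K) = e (j : WeilGroup K) ^ (p - 1) := by
      rw [← map_pow]; exact hcongr _ _ (by rw [map_pow, hartj])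
    change red (e (i : WeilGroup K)) = 1
    rw [heij, map_pow]
    exact ZMod.units_pow_card_sub_one_eq_one p _
  -- equal indices force `ker f₁ = ker f₂`
  have hge : f₁.ker ≤ f₂.ker := by
    have h := Subgroup.relIndex_mul_index hle
    rw [hcard₁, hcard₂] at h
    have h1 : f₂.ker.relIndex f₁.ker = 1 := by
      have hp1 : p - 1 ≠ 0 := Nat.sub_ne_zero_of_lt hp.one_lt
      exact (mul_eq_right₀ hp1).mp h
    exact Subgroup.relIndex_eq_one.mp h1
  -- but `f₂ x = -1 ≠ 1` while `f₁ x = 1`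
  have hx₁ : (⟨x, hx⟩ : I) ∈ f₁.ker := by
    rw [MonoidHom.mem_ker]
    change red (e x) = 1
    rw [hex1, map_one]
  have hx₂ := hge hx₁
  rw [MonoidHom.mem_ker] at hx₂
  have hval : ((f₂ ⟨x, hx⟩ : (IsLocalRing.ResidueField A)ˣ) : IsLocalRing.ResidueField A) = -1 := by
    rw [hf₂, MonoidHom.comp_apply, ValuationSubring.coe_unitGroupToResidueFieldUnits_apply]
    have h1 : (A.unitGroupMulEquiv (aU ⟨x, hx⟩) : A) = -1 := by
      apply Subtype.ext
      rw [ValuationSubring.coe_unitGroupMulEquiv_apply, haU_coe]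
      change ((art x : Kˣ) : K) = -1
      rw [hax, Units.val_neg, Units.val_one]
    rw [h1, map_neg, map_one]
    rfl
  rw [hx₂, Units.val_one] at hval
  have hchar' : ringChar (IsLocalRing.ResidueField A) ≠ 2 := by
    change ringChar 𝓀[K] ≠ 2
    rw [hchar]; exact hp2
  exact Ring.neg_one_ne_one_of_char_ne_two hchar' hval.symm

end LocalKey

end Summit.Langlands.Langlands.Theorems.TensorSquareParallel

end
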